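/-
COR-CM (cell pub-hodgecm2, stage 2 of the Hodge ladder) — TRANSPOSITION SURGE, DICTIONARY ITEM (vi) of rfwf v3 §4.2 (tex
ll. 261–265): the S6 END DISPLAY of hodge-director/ITEM6-SPLIT.md (owners «tr-prover-6 + lead»; CLAIM HOME/INBOX l.3897,
2026-08-21T14:00Z; re-taken l.4018; rule (1) NEW path named there).  Seat prover-pub-hodgecm2-tr-prover-6 (gen 2).  Theorems only: no
`def`, no instance, no notation, no `variable` named facts, nothing cited as a record, nothing asserted, no `sorry`.  THIN: the S2
junction is item6-p1's `Transposition/Item6SupplyAsPrinted.lean` (S2 owner; guarded per RULING «AS-PRINTED JUNCTION T1», lead l.4000),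
consumed BY NAME — no junction theorem is restated here (v2 of this file, md5 7bf47c377a70, carried its own `_guarded` copy while #2 was
unfiled; dropped to avoid twins once item6-p1 froze 2912d5378342 with identical binder texts, HOME/INBOX l.4254).

WHAT THIS FILE IS — the TREE-LEVEL END of the kernel test asked for by the coordinator's rulings of 2026-08-21T13:05:07Z / 15:33:56Z (2)
(«REWIRE … so that the ONLY cite binders consumed are these AS-PRINTED statements; if the transposed proof needs anything beyond the
printed hypotheses THE KERNEL MUST FAIL TO CLOSE — report EXACTLY which»): `HC_CM` from [Liu 2021, Thm. 4.18] EXACTLY AS PRINTED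
(`Literature.NumberTheory.Automorphic.Liu2021.Thm418AsPrinted`, p277833 ✔) with EVERY further binder visible BY NAME and GUARDED to the
range the proof consumes, plus the in-kernel certificate ON THE DISPLAY'S OWN BINDERS that the one non-printed, non-carrier Liu-side
binder `hMatch` is — given the printed theorem and its three printed-elsewhere carriers — EQUIVALENT to the displayed leaf B01-S
`U_rec.FaceSupply`.  [GR91 Prop. 3.1.1] (`GelbartRogawski1991.Prop311AsPrinted`, p277859 ✔) is IDLE on this (saturated-set) path and
is not imported.  FRAMING (COORDINATOR RULING 2026-08-21T11:55:35Z): HC_CM is NOT proved — `hMatch` and `hD` are not inhabited.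
ERRATUM carried (lead, HOME/INBOX l.3831 (2) / l.3941 (1); AUDIT-CITESCOPE §1.4): `Item6SupplyAssembly.lean`:95–96 — `supply` is NOT
attributed to [GR91 Prop. 3.1.1] (that is the splitting, GDZ p. 455 L1–3); non-vanishing is not in GR91 §3.1.
T5: consistency check by pub-hodgecm2-t5-consist-1 2026-08-21T16:48:06Z — HCCMOfAsPrinted.lean v3 md5 f958ec5655a6 sha256 4f4040d8e654 (217 l.) —
NO CONTRADICTION DERIVED (line of record for THIS file, HOME/INBOX l.4308; probe `HOME/pub-hodgecm2-t5-consist-1/T5-HCCMOfAsPrinted-v3.lean`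
sha256 fe6852a02699, 2068 l., farm rc 0 · 0 err · 0 warn · 0 sorry · trio; «False from {hU,D,hLiu,hObj,hChi,hω,hMatch,hD} = ¬(U_rec.FaceSupply ∧
Dict U_rec) exactly»; the landed bytes differ from f958ec5655a6 by this docstring paragraph and by moving §A's `variable (hHD) (hI) (h₁) (h₃)` line into the
signature of `thm418AsPrinted_match_iff_faceSupply` — gate lint `review.smuggling` on `variable` named facts; the ELABORATED statements of both
theorems are identical to f958ec5655a6's, binder texts otherwise untouched; re-confirmation asked on the final md5).  Earlier line on v2:
T5: consistency check by pub-hodgecm2-t5-consist-1 2026-08-21T16:27:18Z — HCCMOfAsPrinted.lean md5 7bf47c377a70 — NO CONTRADICTION DERIVED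
(attempts: (a)–(c),(e) as for item6-p1's junction; (d) END DISPLAY False ⟺ ¬(U_rec.FaceSupply ∧ hD) [`T5.hccm_not_and_of_false`, hD verbatim
as `T5.Dict`]; hD attacked: emb := 0 killed by tree HR(2,0) `universeOf_hodgeRiemann_pms` — not a model, not a contradiction; landed
`T5.dict_emb_injOn_F_two`; sign / level / B01-S-joint attacks give no False) [HOME/INBOX l.4243; probe
`HOME/pub-hodgecm2-t5-consist-1/T5-Item6SupplyAsPrinted-HCCM.lean` sha256 a03ff7f28c60].  The binder TEXTS of the two theorems kept in this
thin version (`hc_cm_of_thm418AsPrinted_of_dictionary`, `thm418AsPrinted_match_iff_faceSupply[_rec]`) are byte-identical to those of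
7bf47c377a70 = t5-consist-1's sets (d) and (c); earlier: htheta-x2 g2 T1 v3 (l.4051, stuck `⊢ 6 ≤ Module.finrank ℚ F₀.K`), x2 replay (l.4057),
b28 cone audit §T4 (l.4223: exactly 9 named binders, INTERNAL 0, no Liu/GR91 constant consumed as a record).
STRENGTH (lead l.4000 (3) / l.4070 (ii) wording): GIVEN hLiu/hObj/hChi/hω, `hMatch ↔ U.FaceSupply` (§A) and `(∃ D, five) ↔ U.FaceSupply`
(item6-p1 `Model.exists_thm418Binders_iff_faceSupply`) — i.e. «again ↔ B01-S», in those words: the as-printed rewire certifies SCOPE, not SUPPLY.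
-/
import Summits.HodgeConjecture.CorCM.B01.Transposition.Item6SupplyAsPrinted
import Summits.HodgeConjecture.CorCM.B01.Transposition.Item6HoldsRec
import HarnessLib

/-!
# `HC_CM` from [Liu 2021, Thm. 4.18] AS PRINTED — the END DISPLAY of transposition item (vi), with its residual certified

Universe of record `U_rec := Model.picardCMUniverse exists_isReal_hodgeModel_holds hodgePQ_independent_of_hodgeModel_holds
BallQuotient.ballQuotientUniformised_holds cmAbelianVarietyRealised_holds`.

## §B  The END DISPLAY

`Model.hc_cm_of_thm418AsPrinted_of_dictionary (U) (hU : U = U_rec) (D) (hLiu) (hObj) (hChi) (hω) (hMatch) (hD) : HC_CM`.  Per face context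
the consumer supplies ITS OWN datum `D F ι₁ V Φ : Thm418Data F⁺ F` of [Liu 2021] §4.2 (lit-liu-asprinted's statement-exact carriers; Liu's
`E := F`, `F := F⁺`); the Liu-side binders — ALL demanded only where the proof consumes them, `F` Galois, `6 ≤ [F:ℚ]`, `ι₁ ∈ Φ` (lead l.4000;
b01-idea-1 IDEA-1m §2/§4, b01-idea-2 IDEA-2o; typed over all CM fields the object match is intended-FALSE — at every D₄-quartic `F` the reflex
field of `(F, Φ_μ)` is not a subfield of `F`, [Liu 2021] Cor. 4.20 + [Shimura 1971] —, and htheta-x2 g2 derived `False` from the unguarded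
family at `ℚ(ζ₄)`/`ℙ²`, `X2S2T1.junction_hypotheses_inconsistent`) — are exactly item6-p1's (`Transposition/Item6SupplyAsPrinted.lean`):
* `hLiu`   — THE CITE BINDER, Thm. 4.18 exactly as printed for that datum (`Liu2021.Thm418AsPrinted`);
* `hObj`   — `𝒜(μ) ≠ ∅` ([Liu 2021] Prop. 4.6 (1), `FJcycle.tex` l. 1969 — printed, NOT part of Thm. 4.18);
* `hChi`   — one automorphic character of `E¹\(𝔸_E^∞)¹` (Def. 4.11 l. 2090; the trivial one);
* `hω`     — each `ω(μ,ε,χ)` has a non-zero vector fixed by an open compact subgroup (Def. 4.11 «irreducible admissible»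
             l. 2094–2096 + App. D Lem. D.1 (1) l. 5226–5229 — printed, NOT part of Thm. 4.18; carrier level);
* `hMatch` — THE OBJECT MATCH (ITEM6-SPLIT §5 U1–U3; item6-p1 `S2-ASPRINTED-CHAIN.md` C0/C6a/C6b*): a non-zero element of
             `Hom_E(A_K, A_μ)_ℚ` at an open compact `K` yields a non-zero homomorphism `Alb(P_Γ(V)) → A_{(F,Φ)}` at some level `Γ` of
             the tree's `V`-tower — NOT printed, NOT a tree theorem (the pinning lanes pin-1/2/3 and own-htheta's
             `Item6SupplyPinned.lean` split it as hReach/hCM);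
and `hD` = the ∀ι₁ ∀V `L²`-dictionary-with-isolation clause of items (iii)+(v) at `Θ := Uiso` — VERBATIM the landed binder of
`Model.hc_cm_of_supply_of_dictionary_of_eq` (`Transposition/Item6HoldsRec.lean`:211–224, p279831; its `Gen12`-type content includes THETA
EXHAUSTION of `U_ψ`, [Liu 2021] Prop. 4.13 / Rem. 4.14, the «price of the saturated choice» recorded there; red-team hD row: tgtbt-1).
Composition BY NAME: `Model.hc_cm_of_supply_of_dictionary_of_eq` ∘ `Model.exists_supplyWitness_of_thm418AsPrinted` (item6-p1; = item6-p3's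
`Liu2021.Thm418Data.exists_level_homK_ne_zero` then `Model.faceSupply_of_albaneseFactor` then `Model.exists_supplyWitness_of_faceSupply`).

## §A  The certificate on the display's own binders: the residual IS B01-S

`Model.thm418AsPrinted_match_iff_faceSupply[_rec]`: GIVEN `hLiu`/`hObj`/`hChi`/`hω` (intended TRUE; jointly INHABITED in the kernel at
item6-p3's scalar datum, `Liu2021.Thm418Data.scalarDatum_consistent`), the guarded `hMatch` is LOGICALLY EQUIVALENT to `U.FaceSupply`
(⇒ item6-p1's `faceSupply_of_thm418AsPrinted`; ⇐ item6-p1's `exists_albaneseHom_ne_zero_of_faceSupply`, for every datum, no witness).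
With item6-p1's family form `exists_thm418Binders_iff_faceSupply` this is the kernel reading of the ruling's test (lead FINDING l.4000 (3)):
from Thm. 4.18 AS PRINTED the kernel does NOT close HC_CM; what it refuses to close without is not a printed hypothesis of Thm. 4.18 left
undischarged for general `F` (all of l. 1878 / l. 2053 / Def. 4.16 are met at every face) but the object match, whose content given the
printed binders is EXACTLY the supply leaf B01-S — uniform in `[F:ℚ] ≥ 6` and in the face —, plus `hD`.  So the display reads, honestly:
«HC_CM ⇐ [Liu 2021 Thm. 4.18 as printed + Prop. 4.6 (1) + Def. 4.11/Lem. D.1 (1) carriers] + [object match ≡ B01-S] +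
[dictionary-with-isolation (iii)+(v)]».  HC_CM is NOT proved.

References (context; nothing below is cited as a record): Y. Liu, *Fourier–Jacobi cycles and arithmetic relative trace formula*,
Camb. J. Math. 9 (2021), arXiv:2102.11518 (`FJcycle.tex` md5 6db49a74122d): Thm. 4.18 l. 2232–2245, Prop. 4.6 (1) l. 1969,
Def. 4.11 l. 2083–2097, Def. 4.12 l. 2102–2110, Cor. 4.20 l. 2301–2316, App. C l. 4614–4645, Lem. D.1 l. 5226–5229.
-/

noncomputable section

open scoped TensorProduct InnerProductSpace DirectSum

namespace Summit.HodgeConjecture.CorCM.Model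

open CategoryTheory AlgebraicGeometry NumberField
open Literature.AlgebraicGeometry.Motives
open Literature.AlgebraicGeometry.Motives.HodgeStructure (conj)
open Literature.AlgebraicGeometry.HodgeTheory
open Literature.NumberTheory.Automorphic
open Literature.NumberTheory.Automorphic.PicardCM
open Literature.NumberTheory.Automorphic.Liu2021

/-! ## §A  THE CERTIFICATE — under the printed theorem and its carriers, the object match IS the leaf B01-S -/

/-- **THE CERTIFICATE** (`U = picardCMUniverse hHD hI h₁ h₃`): GIVEN the cite binder `hLiu` ([Liu 2021, Thm. 4.18] as printed, for the
consumer's data) and the three printed-elsewhere carriers `hObj` (Prop. 4.6 (1)), `hChi` (Def. 4.11), `hω` (Def. 4.11 + Lem. D.1 (1)) —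
all intended TRUE and jointly inhabited in the kernel (item6-p3 `Liu2021.Thm418Data.scalarDatum_consistent`) —, the guarded object-match
binder `hMatch` of the display is LOGICALLY EQUIVALENT to the displayed leaf B01-S `U.FaceSupply` (⇒ item6-p1's `faceSupply_of_thm418AsPrinted`;
⇐ item6-p1's `exists_albaneseHom_ne_zero_of_faceSupply`, which needs no witness).  Reading for the rulings of 2026-08-21T13:05:07Z /
15:33:56Z (2): from Thm. 4.18 AS PRINTED the kernel does not close S2, and what it refuses to close without is — in content — the supply
leaf itself, not a printed hypothesis of Thm. 4.18 undischarged for general `F`; uniform in `[F:ℚ] ≥ 6` and in the face (b01-idea-1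
IDEA-1m F4, over Liu's datum; family form: item6-p1 `exists_thm418Binders_iff_faceSupply`). [folklore] -/
theorem thm418AsPrinted_match_iff_faceSupply
    (hHD : exists_isReal_hodgeModel) (hI : hodgePQ_independent_of_hodgeModel)
    (h₁ : BallQuotientUniformised) (h₃ : CMAbelianVarietyRealised)
    (D : ∀ (F : CMField) (ι₁ : F →+* ℂ) (_ : HermSpace3 F ι₁) (_ : CMType F), Thm418Data (maximalRealSubfield F) F)
    (hLiu : ∀ (F : CMField), IsGalois ℚ F → 6 ≤ Module.finrank ℚ F → ∀ (Φ : CMType F) (ι₁ : F →+* ℂ), ι₁ ∈ Φ.1 →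
      ∀ V : HermSpace3 F ι₁, Thm418AsPrinted (D F ι₁ V Φ))
    (hObj : ∀ (F : CMField), IsGalois ℚ F → 6 ≤ Module.finrank ℚ F → ∀ (Φ : CMType F) (ι₁ : F →+* ℂ), ι₁ ∈ Φ.1 →
      ∀ V : HermSpace3 F ι₁, Nonempty (D F ι₁ V Φ).Obj)
    (hChi : ∀ (F : CMField), IsGalois ℚ F → 6 ≤ Module.finrank ℚ F → ∀ (Φ : CMType F) (ι₁ : F →+* ℂ), ι₁ ∈ Φ.1 →
      ∀ V : HermSpace3 F ι₁, Nonempty (D F ι₁ V Φ).Chi)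
    (hω : ∀ (F : CMField), IsGalois ℚ F → 6 ≤ Module.finrank ℚ F → ∀ (Φ : CMType F) (ι₁ : F →+* ℂ), ι₁ ∈ Φ.1 →
      ∀ (V : HermSpace3 F ι₁) (i : (D F ι₁ V Φ).AdmIndex),
        ∃ K₁ : Subgroup (D F ι₁ V Φ).G, IsOpenCompact K₁ ∧
          ∃ v : (D F ι₁ V Φ).omegaAt i, v ≠ 0 ∧ ∀ k ∈ K₁, (D F ι₁ V Φ).rhoAt i k v = v) :
    (∀ (F : CMField), IsGalois ℚ F → 6 ≤ Module.finrank ℚ F → ∀ (Φ : CMType F) (ι₁ : F →+* ℂ), ι₁ ∈ Φ.1 →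
      ∀ (V : HermSpace3 F ι₁) (K : Subgroup (D F ι₁ V Φ).G) (Dμ : (D F ι₁ V Φ).Obj) (φ : (D F ι₁ V Φ).HomK K Dμ),
        IsOpenCompact K → φ ≠ 0 →
          ∃ (Γ : Level V) (𝒥 : Jacobian (Var.scheme (ballQuotientUniformisedDatum_of h₁) h₃ (.pms (pmsCode F ι₁ V Γ))))
            (u : 𝒥.J ⟶ (cmRealisation h₃ (cmCode F Φ)).AV), u ≠ 0) ↔
      (picardCMUniverse hHD hI h₁ h₃).FaceSupply :=
  ⟨faceSupply_of_thm418AsPrinted hHD hI h₁ h₃ D hLiu hObj hChi hω,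
    fun hS F hG h6 Φ ι₁ hι V _ _ _ _ _ => exists_albaneseHom_ne_zero_of_faceSupply hHD hI h₁ h₃ hS F hG h6 Φ ι₁ hι V⟩

/-! ## §B  THE END DISPLAY on the universe of record -/

section EndState

/-- **END DISPLAY (ITEM6-SPLIT S6) on THE universe of record (`hU : U = U_rec`, instantiate with `rfl`): `HC_CM` from [Liu 2021,
Thm. 4.18] AS PRINTED + its named non-printed binders (guarded) + the `L²` dictionary with isolation — and NOTHING else.**  Per face
context the consumer's own datum `D F ι₁ V Φ : Thm418Data F⁺ F`; binders, each demanded only for Galois CM `F` with `6 ≤ [F:ℚ]`,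
`Φ ∋ ι₁` and (for `hD`) admissible `ι₁`: `hLiu` = THE CITE BINDER [Liu 2021, Thm. 4.18] exactly as printed
(`Liu2021.Thm418AsPrinted`); `hObj` = Prop. 4.6 (1) (l. 1969); `hChi` = Def. 4.11 (l. 2090); `hω` = Def. 4.11 + Lem. D.1 (1)
(l. 2094–2096, 5226–5229); `hMatch` = THE OBJECT MATCH U1–U3 (not printed, not a tree theorem; by §A EQUIVALENT, given the four
before it, to B01-S `U_rec.FaceSupply`); `hD` = items (iii)+(v): per `(F, f, ι₁, V)` the `L²` dictionary `(HG, emb, cover,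
emb_cover, inner_emb)` with item (v)'s isolation for the saturated theta sets `Θ := Uiso` in closed-span form (its content includes
THETA EXHAUSTION of `U_ψ`, [Liu 2021] Prop. 4.13 / Rem. 4.14, in no as-printed binder — `Item6HoldsRec.lean`, module docstring).
Composition BY NAME: `hc_cm_of_supply_of_dictionary_of_eq` (tr-prover-6, p279831) ∘ `exists_supplyWitness_of_thm418AsPrinted` (item6-p1).  [GR91 Prop. 3.1.1] does not enter.  HC_CM is NOT proved: `hMatch` and `hD` are not
inhabited. [folklore] -/
theorem hc_cm_of_thm418AsPrinted_of_dictionary (U : Universe)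
    (hU : U = picardCMUniverse exists_isReal_hodgeModel_holds hodgePQ_independent_of_hodgeModel_holds
      BallQuotient.ballQuotientUniformised_holds cmAbelianVarietyRealised_holds)
    (D : ∀ (F : CMField) (ι₁ : F →+* ℂ) (_ : HermSpace3 F ι₁) (_ : CMType F), Thm418Data (maximalRealSubfield F) F)
    (hLiu : ∀ (F : CMField), IsGalois ℚ F → 6 ≤ Module.finrank ℚ F → ∀ (Φ : CMType F) (ι₁ : F →+* ℂ), ι₁ ∈ Φ.1 →
      ∀ V : HermSpace3 F ι₁, Thm418AsPrinted (D F ι₁ V Φ))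
    (hObj : ∀ (F : CMField), IsGalois ℚ F → 6 ≤ Module.finrank ℚ F → ∀ (Φ : CMType F) (ι₁ : F →+* ℂ), ι₁ ∈ Φ.1 →
      ∀ V : HermSpace3 F ι₁, Nonempty (D F ι₁ V Φ).Obj)
    (hChi : ∀ (F : CMField), IsGalois ℚ F → 6 ≤ Module.finrank ℚ F → ∀ (Φ : CMType F) (ι₁ : F →+* ℂ), ι₁ ∈ Φ.1 →
      ∀ V : HermSpace3 F ι₁, Nonempty (D F ι₁ V Φ).Chi)
    (hω : ∀ (F : CMField), IsGalois ℚ F → 6 ≤ Module.finrank ℚ F → ∀ (Φ : CMType F) (ι₁ : F →+* ℂ), ι₁ ∈ Φ.1 →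
      ∀ (V : HermSpace3 F ι₁) (i : (D F ι₁ V Φ).AdmIndex),
        ∃ K₁ : Subgroup (D F ι₁ V Φ).G, IsOpenCompact K₁ ∧
          ∃ v : (D F ι₁ V Φ).omegaAt i, v ≠ 0 ∧ ∀ k ∈ K₁, (D F ι₁ V Φ).rhoAt i k v = v)
    (hMatch : ∀ (F : CMField), IsGalois ℚ F → 6 ≤ Module.finrank ℚ F → ∀ (Φ : CMType F) (ι₁ : F →+* ℂ), ι₁ ∈ Φ.1 →
      ∀ (V : HermSpace3 F ι₁) (K : Subgroup (D F ι₁ V Φ).G) (Dμ : (D F ι₁ V Φ).Obj) (φ : (D F ι₁ V Φ).HomK K Dμ),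
        IsOpenCompact K → φ ≠ 0 →
          ∃ (Γ : Level V) (𝒥 : Jacobian (Var.scheme (ballQuotientUniformisedDatum_of BallQuotient.ballQuotientUniformised_holds)
              cmAbelianVarietyRealised_holds (.pms (pmsCode F ι₁ V Γ))))
            (u : 𝒥.J ⟶ (cmRealisation cmAbelianVarietyRealised_holds (cmCode F Φ)).AV), u ≠ 0)
    (hD : ∀ (F : CMField), IsGalois ℚ F → 6 ≤ Module.finrank ℚ F → ∀ (f : Face F) (ι₁ : F →+* ℂ), f.Admissible ι₁ →
      ∀ V : HermSpace3 F ι₁,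
        ∃ (HG : Type) (_ : NormedAddCommGroup HG) (_ : InnerProductSpace ℂ HG)
          (emb : ∀ Γ : Level V, U.CohC (U.pms F ι₁ V Γ) 2 →ₗ[ℂ] HG)
          (cover : ∀ (Γ Γ' : Level V), Γ' ≤ Γ → U.Mor (U.pms F ι₁ V Γ') (U.pms F ι₁ V Γ)),
          (∀ (Γ : Level V) (ω₁ ω₂ : U.CohC (U.pms F ι₁ V Γ) 1), ω₁ ∈ U.Uiso Γ F (f.psi 0) ι₁ → ω₂ ∈ U.Uiso Γ F (f.psi 1) ι₁ →
            emb Γ (U.cup2C (U.pms F ι₁ V Γ) 1 ω₁ ω₂) ∈ (Submodule.span ℂ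
              {x : HG | ∃ (Γ' : Level V), ∃ ω₃ ∈ U.Uiso Γ' F (f.psi 2) ι₁, ∃ ω₄ ∈ U.Uiso Γ' F (f.psi 3) ι₁,
                x = emb Γ' (U.cup2C (U.pms F ι₁ V Γ') 1 ω₃ ω₄)}).topologicalClosure) ∧
          (∀ (Γ Γ' : Level V) (hle : Γ' ≤ Γ) (x : U.CohC (U.pms F ι₁ V Γ) 2),
            emb Γ' (U.pullC (cover Γ Γ' hle) 2 x) = emb Γ x) ∧
          (∀ Γ : Level V, ∃ c : ℂ, c ≠ 0 ∧ ∀ x y : U.CohC (U.pms F ι₁ V Γ) 2,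
            x ∈ (U.hodge (U.pms F ι₁ V Γ) 2).F 2 → y ∈ (U.hodge (U.pms F ι₁ V Γ) 2).F 2 →
              ⟪emb Γ y, emb Γ x⟫_ℂ = c * U.trC (U.pms F ι₁ V Γ) 4 (U.cup2C (U.pms F ι₁ V Γ) 2 x (conj y)))) :
    HC_CM := by
  subst hU
  exact hc_cm_of_supply_of_dictionary_of_eq _ rfl
    (exists_supplyWitness_of_thm418AsPrinted _ _ _ _ D hLiu hObj hChi hω hMatch) hD

/-- **THE CERTIFICATE on THE universe of record**: given `hLiu`/`hObj`/`hChi`/`hω` as in the display, its binder `hMatch` is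
EQUIVALENT to the displayed leaf B01-S `U_rec.FaceSupply` (`thm418AsPrinted_match_iff_faceSupply` at the four tree theorems
`exists_isReal_hodgeModel_holds`, `hodgePQ_independent_of_hodgeModel_holds`, `BallQuotient.ballQuotientUniformised_holds`,
`cmAbelianVarietyRealised_holds`).  HC_CM is NOT proved. [folklore] -/
theorem thm418AsPrinted_match_iff_faceSupply_rec
    (D : ∀ (F : CMField) (ι₁ : F →+* ℂ) (_ : HermSpace3 F ι₁) (_ : CMType F), Thm418Data (maximalRealSubfield F) F)
    (hLiu : ∀ (F : CMField), IsGalois ℚ F → 6 ≤ Module.finrank ℚ F → ∀ (Φ : CMType F) (ι₁ : F →+* ℂ), ι₁ ∈ Φ.1 →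
      ∀ V : HermSpace3 F ι₁, Thm418AsPrinted (D F ι₁ V Φ))
    (hObj : ∀ (F : CMField), IsGalois ℚ F → 6 ≤ Module.finrank ℚ F → ∀ (Φ : CMType F) (ι₁ : F →+* ℂ), ι₁ ∈ Φ.1 →
      ∀ V : HermSpace3 F ι₁, Nonempty (D F ι₁ V Φ).Obj)
    (hChi : ∀ (F : CMField), IsGalois ℚ F → 6 ≤ Module.finrank ℚ F → ∀ (Φ : CMType F) (ι₁ : F →+* ℂ), ι₁ ∈ Φ.1 →
      ∀ V : HermSpace3 F ι₁, Nonempty (D F ι₁ V Φ).Chi)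
    (hω : ∀ (F : CMField), IsGalois ℚ F → 6 ≤ Module.finrank ℚ F → ∀ (Φ : CMType F) (ι₁ : F →+* ℂ), ι₁ ∈ Φ.1 →
      ∀ (V : HermSpace3 F ι₁) (i : (D F ι₁ V Φ).AdmIndex),
        ∃ K₁ : Subgroup (D F ι₁ V Φ).G, IsOpenCompact K₁ ∧
          ∃ v : (D F ι₁ V Φ).omegaAt i, v ≠ 0 ∧ ∀ k ∈ K₁, (D F ι₁ V Φ).rhoAt i k v = v) :
    (∀ (F : CMField), IsGalois ℚ F → 6 ≤ Module.finrank ℚ F → ∀ (Φ : CMType F) (ι₁ : F →+* ℂ), ι₁ ∈ Φ.1 →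
      ∀ (V : HermSpace3 F ι₁) (K : Subgroup (D F ι₁ V Φ).G) (Dμ : (D F ι₁ V Φ).Obj) (φ : (D F ι₁ V Φ).HomK K Dμ),
        IsOpenCompact K → φ ≠ 0 →
          ∃ (Γ : Level V) (𝒥 : Jacobian (Var.scheme (ballQuotientUniformisedDatum_of BallQuotient.ballQuotientUniformised_holds)
              cmAbelianVarietyRealised_holds (.pms (pmsCode F ι₁ V Γ))))
            (u : 𝒥.J ⟶ (cmRealisation cmAbelianVarietyRealised_holds (cmCode F Φ)).AV), u ≠ 0) ↔
      (picardCMUniverse exists_isReal_hodgeModel_holds hodgePQ_independent_of_hodgeModel_holds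
        BallQuotient.ballQuotientUniformised_holds cmAbelianVarietyRealised_holds).FaceSupply :=
  thm418AsPrinted_match_iff_faceSupply _ _ _ _ D hLiu hObj hChi hω

end EndState

end Summit.HodgeConjecture.CorCM.Model

end
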